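/-
Copyright: harness cell b2b-lgcu-borel (gen 6).  Honest framing: the VALUE here is a THEOREM /
a DECIDABLE VERDICT / a CERTIFICATE — NOT summit progress.
-/
import Summits.MatrixMultiplication.MatrixMultiplication.Theorems.SubgroupIdentityDesigns.Negative.ShiftedSubgroupCount

/-!
# Points of the line `α + s = (s+1)β` on a subgroup of `𝔽ₚˣ × 𝔽ₚˣ`

Generalisation of `ShiftedSubgroupCount` from product subgroups `A × B` to an arbitrary subgroup
`Γ ≤ 𝔽ₚˣ × 𝔽ₚˣ`: if `N` is the number of `(α, β) ∈ Γ` with `α + s = (s + 1)β` (`s ≠ 0, -1`), then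
`|Γ| ≤ (p - 1)(N + 1 + √p)`.  Proof: orthogonality of Dirichlet characters on both coordinates,
the fact that a character sum over `Γ` is `|Γ|` or `0`, and the Jacobi-sum bound `‖J‖ ≤ √p`
(`ShiftedSubgroupCount.norm_G_le`).  In particular a subgroup `Γ` on which `(1,1)` is the only
point of the line has `|Γ| ≤ (p-1)(2 + √p)`; this is the input for the Weil-type volume ceiling
of ALL toral (unipotent-free) Borel TPP triples (`BorelToralCeiling`).  VALUE = a theorem,
NOT summit progress.
-/

open scoped BigOperators Classical

namespace Summit.MatrixMultiplication.MatrixMultiplication.Theorems.SubgroupIdentityDesigns.Negative.ShiftedSubgroup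

variable {p : ℕ} [hp : Fact p.Prime]

/-! ## Character sums over a subgroup of `𝔽ₚˣ × 𝔽ₚˣ` -/

/-- `pairSum Γ θ χ = ∑_{(α,β) ∈ Γ} θ(α⁻¹) χ(β⁻¹)`. -/
noncomputable def pairSum (Γ : Subgroup ((ZMod p)ˣ × (ZMod p)ˣ)) (θ χ : DirichletCharacter ℂ p) :
    ℂ :=
  ∑ g : Γ, θ ((((g : (ZMod p)ˣ × (ZMod p)ˣ).1)⁻¹ : (ZMod p)ˣ) : ZMod p) *
    χ ((((g : (ZMod p)ˣ × (ZMod p)ˣ).2)⁻¹ : (ZMod p)ˣ) : ZMod p)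

/-- Translation invariance: `θ(α₀) χ(β₀) · pairSum Γ θ χ = pairSum Γ θ χ` for `(α₀, β₀) ∈ Γ`. -/
theorem mul_pairSum (Γ : Subgroup ((ZMod p)ˣ × (ZMod p)ˣ)) (θ χ : DirichletCharacter ℂ p)
    (g₀ : Γ) :
    θ (((g₀ : (ZMod p)ˣ × (ZMod p)ˣ).1 : (ZMod p)ˣ) : ZMod p) *
        χ (((g₀ : (ZMod p)ˣ × (ZMod p)ˣ).2 : (ZMod p)ˣ) : ZMod p) * pairSum Γ θ χ
      = pairSum Γ θ χ := by
  unfold pairSum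
  rw [Finset.mul_sum]
  refine Fintype.sum_bijective (fun g => g * g₀⁻¹) (Group.mulRight_bijective g₀⁻¹) _ _
    fun g => ?_
  rw [mul_mul_mul_comm, ← map_mul, ← map_mul, ← Units.val_mul, ← Units.val_mul]
  simp only [Subgroup.coe_mul, Subgroup.coe_inv, Prod.fst_mul, Prod.fst_inv, Prod.snd_mul,
    Prod.snd_inv, mul_inv_rev, inv_inv]

/-- A character sum over `Γ` is `|Γ|` if the character is trivial on `Γ`, else `0`. -/
theorem pairSum_eq (Γ : Subgroup ((ZMod p)ˣ × (ZMod p)ˣ)) (θ χ : DirichletCharacter ℂ p) :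
    pairSum Γ θ χ =
      if (∀ g : Γ, θ (((g : (ZMod p)ˣ × (ZMod p)ˣ).1 : (ZMod p)ˣ) : ZMod p) *
          χ (((g : (ZMod p)ˣ × (ZMod p)ˣ).2 : (ZMod p)ˣ) : ZMod p) = 1)
      then (Nat.card Γ : ℂ) else 0 := by
  split_ifs with hall
  · unfold pairSum
    rw [Finset.sum_congr rfl fun (g : Γ) _ => show
      θ ((((g : (ZMod p)ˣ × (ZMod p)ˣ).1)⁻¹ : (ZMod p)ˣ) : ZMod p) *
        χ ((((g : (ZMod p)ˣ × (ZMod p)ˣ).2)⁻¹ : (ZMod p)ˣ) : ZMod p) = 1 by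
        have := hall g⁻¹
        rwa [Subgroup.coe_inv, Prod.fst_inv, Prod.snd_inv] at this]
    simp [Nat.card_eq_fintype_card]
  · push Not at hall
    obtain ⟨g₀, g₀ne⟩ := hall
    exact eq_zero_of_mul_eq_self_left g₀ne (mul_pairSum Γ θ χ g₀)

/-- `‖pairSum Γ θ χ‖ = Re (pairSum Γ θ χ)`. -/
theorem norm_pairSum (Γ : Subgroup ((ZMod p)ˣ × (ZMod p)ˣ)) (θ χ : DirichletCharacter ℂ p) :
    ‖pairSum Γ θ χ‖ = (pairSum Γ θ χ).re := by
  rw [pairSum_eq]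
  split_ifs <;> simp

/-- Double orthogonality at one point: `∑_θ ∑_χ θ(x) χ(y) = (p-1)² [x = 1][y = 1]`. -/
theorem sum_sum_char (x y : ZMod p) :
    ∑ θ : DirichletCharacter ℂ p, ∑ χ : DirichletCharacter ℂ p, θ x * χ y
      = if x = 1 ∧ y = 1 then ((p : ℂ) - 1) ^ 2 else 0 := by
  simp_rw [← Finset.mul_sum]
  rw [← Finset.sum_mul, DirichletCharacter.sum_characters_eq,
    DirichletCharacter.sum_characters_eq, Nat.totient_prime hp.out, Nat.cast_sub hp.out.one_le]
  by_cases hx : x = 1 <;> by_cases hy : y = 1 <;> simp [hx, hy, sq]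

/-- Orthogonality: `∑_θ ∑_χ pairSum Γ θ χ = (p - 1)²` (only `(1,1)` contributes). -/
theorem sum_pairSum (Γ : Subgroup ((ZMod p)ˣ × (ZMod p)ˣ)) :
    ∑ θ : DirichletCharacter ℂ p, ∑ χ : DirichletCharacter ℂ p, pairSum Γ θ χ
      = ((p : ℂ) - 1) ^ 2 := by
  calc ∑ θ : DirichletCharacter ℂ p, ∑ χ : DirichletCharacter ℂ p, pairSum Γ θ χ
      = ∑ θ : DirichletCharacter ℂ p, ∑ g : Γ, ∑ χ : DirichletCharacter ℂ p,
          θ ((((g : (ZMod p)ˣ × (ZMod p)ˣ).1)⁻¹ : (ZMod p)ˣ) : ZMod p) *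
            χ ((((g : (ZMod p)ˣ × (ZMod p)ˣ).2)⁻¹ : (ZMod p)ˣ) : ZMod p) := by
        refine Finset.sum_congr rfl fun θ _ => ?_
        unfold pairSum
        rw [Finset.sum_comm]
    _ = ∑ g : Γ, ∑ θ : DirichletCharacter ℂ p, ∑ χ : DirichletCharacter ℂ p,
          θ ((((g : (ZMod p)ˣ × (ZMod p)ˣ).1)⁻¹ : (ZMod p)ˣ) : ZMod p) *
            χ ((((g : (ZMod p)ˣ × (ZMod p)ˣ).2)⁻¹ : (ZMod p)ˣ) : ZMod p) := Finset.sum_comm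
    _ = ∑ g : Γ, (if (((((g : (ZMod p)ˣ × (ZMod p)ˣ).1)⁻¹ : (ZMod p)ˣ) : ZMod p) = 1 ∧
          ((((g : (ZMod p)ˣ × (ZMod p)ˣ).2)⁻¹ : (ZMod p)ˣ) : ZMod p) = 1)
          then ((p : ℂ) - 1) ^ 2 else 0) := by
        simp_rw [sum_sum_char]
    _ = ((p : ℂ) - 1) ^ 2 := by
        rw [Finset.sum_eq_single (1 : Γ)]
        · simp
        · intro g _ hne
          rw [if_neg]
          rintro ⟨h1, h2⟩
          apply hne
          rw [Units.val_eq_one, inv_eq_one] at h1 h2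
          exact Subtype.ext (Prod.ext h1 h2)
        · intro h1
          exact absurd (Finset.mem_univ _) h1

/-- `∑_θ ∑_χ ‖pairSum Γ θ χ‖ = (p - 1)²`. -/
theorem sum_norm_pairSum (Γ : Subgroup ((ZMod p)ˣ × (ZMod p)ˣ)) :
    ∑ θ : DirichletCharacter ℂ p, ∑ χ : DirichletCharacter ℂ p, ‖pairSum Γ θ χ‖
      = ((p : ℝ) - 1) ^ 2 := by
  simp_rw [norm_pairSum]
  simp_rw [← Complex.re_sum]
  rw [sum_pairSum]
  simp [sq]

/-! ## The line sum over `Γ` and its completion -/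

/-- `lineSum Γ s χ = ∑_{(α,β) ∈ Γ} χ(α + s) χ(β⁻¹)`. -/
noncomputable def lineSum (Γ : Subgroup ((ZMod p)ˣ × (ZMod p)ˣ)) (s : ZMod p)
    (χ : DirichletCharacter ℂ p) : ℂ :=
  ∑ g : Γ, χ ((((g : (ZMod p)ˣ × (ZMod p)ˣ).1 : (ZMod p)ˣ) : ZMod p) + s) *
    χ ((((g : (ZMod p)ˣ × (ZMod p)ˣ).2)⁻¹ : (ZMod p)ˣ) : ZMod p)

/-- Pointwise completion: `∑_θ θ(α⁻¹)χ(β⁻¹) · G s χ θ = (p-1) · χ(α + s) χ(β⁻¹)`. -/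
theorem inner_expand (α β : (ZMod p)ˣ) (s : ZMod p) (χ : DirichletCharacter ℂ p) :
    ∑ θ : DirichletCharacter ℂ p,
        θ ((α⁻¹ : (ZMod p)ˣ) : ZMod p) * χ ((β⁻¹ : (ZMod p)ˣ) : ZMod p) * G s χ θ
      = ((p : ℂ) - 1) * (χ ((α : ZMod p) + s) * χ ((β⁻¹ : (ZMod p)ˣ) : ZMod p)) := by
  calc ∑ θ : DirichletCharacter ℂ p,
        θ ((α⁻¹ : (ZMod p)ˣ) : ZMod p) * χ ((β⁻¹ : (ZMod p)ˣ) : ZMod p) * G s χ θ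
      = ∑ θ : DirichletCharacter ℂ p, ∑ x : ZMod p, χ ((β⁻¹ : (ZMod p)ˣ) : ZMod p) *
          (θ ((α⁻¹ : (ZMod p)ˣ) : ZMod p) * (θ x * χ (x + s))) := by
        refine Finset.sum_congr rfl fun θ _ => ?_
        rw [G, Finset.mul_sum]
        exact Finset.sum_congr rfl fun x _ => by ring
    _ = ∑ x : ZMod p, χ ((β⁻¹ : (ZMod p)ˣ) : ZMod p) * ∑ θ : DirichletCharacter ℂ p,
          θ ((α⁻¹ : (ZMod p)ˣ) : ZMod p) * (θ x * χ (x + s)) := by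
        rw [Finset.sum_comm]
        exact Finset.sum_congr rfl fun x _ => by rw [Finset.mul_sum]
    _ = ∑ x : ZMod p, χ ((β⁻¹ : (ZMod p)ˣ) : ZMod p) *
          (if (α : ZMod p) = x then ((p : ℂ) - 1) * χ (x + s) else 0) := by
        simp_rw [sum_char_coset]
    _ = ((p : ℂ) - 1) * (χ ((α : ZMod p) + s) * χ ((β⁻¹ : (ZMod p)ˣ) : ZMod p)) := by
        simp_rw [mul_ite, mul_zero]
        rw [Finset.sum_ite_eq, if_pos (Finset.mem_univ _)]
        ring

/-- Completion: `∑_θ pairSum Γ θ χ · G s χ θ = (p - 1) · lineSum Γ s χ`. -/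
theorem expand_pair (Γ : Subgroup ((ZMod p)ˣ × (ZMod p)ˣ)) (s : ZMod p)
    (χ : DirichletCharacter ℂ p) :
    ∑ θ : DirichletCharacter ℂ p, pairSum Γ θ χ * G s χ θ
      = ((p : ℂ) - 1) * lineSum Γ s χ := by
  calc ∑ θ : DirichletCharacter ℂ p, pairSum Γ θ χ * G s χ θ
      = ∑ θ : DirichletCharacter ℂ p, ∑ g : Γ,
          θ ((((g : (ZMod p)ˣ × (ZMod p)ˣ).1)⁻¹ : (ZMod p)ˣ) : ZMod p) *
            χ ((((g : (ZMod p)ˣ × (ZMod p)ˣ).2)⁻¹ : (ZMod p)ˣ) : ZMod p) * G s χ θ := by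
        simp_rw [pairSum, Finset.sum_mul]
    _ = ∑ g : Γ, ∑ θ : DirichletCharacter ℂ p,
          θ ((((g : (ZMod p)ˣ × (ZMod p)ˣ).1)⁻¹ : (ZMod p)ˣ) : ZMod p) *
            χ ((((g : (ZMod p)ˣ × (ZMod p)ˣ).2)⁻¹ : (ZMod p)ˣ) : ZMod p) * G s χ θ :=
        Finset.sum_comm
    _ = ∑ g : Γ, ((p : ℂ) - 1) *
          (χ ((((g : (ZMod p)ˣ × (ZMod p)ˣ).1 : (ZMod p)ˣ) : ZMod p) + s) *
            χ ((((g : (ZMod p)ˣ × (ZMod p)ˣ).2)⁻¹ : (ZMod p)ˣ) : ZMod p)) := by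
        simp_rw [inner_expand]
    _ = ((p : ℂ) - 1) * lineSum Γ s χ := by rw [lineSum, Finset.mul_sum]

/-- The line sum for `χ ≠ 1`, `s ≠ 0`: `(p-1)‖lineSum Γ s χ‖ ≤ √p · ∑_θ ‖pairSum Γ θ χ‖`. -/
theorem norm_lineSum_le (Γ : Subgroup ((ZMod p)ˣ × (ZMod p)ˣ)) (s : ZMod p) (hs : s ≠ 0)
    (χ : DirichletCharacter ℂ p) (hχ : χ ≠ 1) :
    ((p : ℝ) - 1) * ‖lineSum Γ s χ‖
      ≤ Real.sqrt p * ∑ θ : DirichletCharacter ℂ p, ‖pairSum Γ θ χ‖ := by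
  have hp1 : (0 : ℝ) ≤ (p : ℝ) - 1 := by
    have : (1 : ℝ) ≤ p := by exact_mod_cast hp.out.one_lt.le
    linarith
  have hn : ((p : ℝ) - 1) * ‖lineSum Γ s χ‖
      = ‖∑ θ : DirichletCharacter ℂ p, pairSum Γ θ χ * G s χ θ‖ := by
    rw [expand_pair, norm_mul]
    congr 1
    rw [show ((p : ℂ) - 1) = (((p : ℝ) - 1 : ℝ) : ℂ) by push_cast; ring, Complex.norm_real,
      Real.norm_of_nonneg hp1]
  rw [hn]
  calc ‖∑ θ : DirichletCharacter ℂ p, pairSum Γ θ χ * G s χ θ‖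
      ≤ ∑ θ : DirichletCharacter ℂ p, ‖pairSum Γ θ χ * G s χ θ‖ := norm_sum_le _ _
    _ ≤ ∑ θ : DirichletCharacter ℂ p, ‖pairSum Γ θ χ‖ * Real.sqrt p := by
        refine Finset.sum_le_sum fun θ _ => ?_
        rw [norm_mul]
        exact mul_le_mul_of_nonneg_left (norm_G_le s hs χ θ hχ) (norm_nonneg _)
    _ = Real.sqrt p * ∑ θ : DirichletCharacter ℂ p, ‖pairSum Γ θ χ‖ := by
        rw [← Finset.sum_mul, mul_comm]

/-! ## Counting points of the line on `Γ` -/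

/-- The number of `(α, β) ∈ Γ` with `α + s = (s + 1)·β`. -/
noncomputable def lineCount (Γ : Subgroup ((ZMod p)ˣ × (ZMod p)ˣ)) (s : ZMod p) : ℕ :=
  Fintype.card {g : Γ //
    (s + 1) * ((((g : (ZMod p)ˣ × (ZMod p)ˣ).2 : (ZMod p)ˣ) : ZMod p))
      = (((g : (ZMod p)ˣ × (ZMod p)ˣ).1 : (ZMod p)ˣ) : ZMod p) + s}

/-- `lineCount` as a sum of indicators. -/
theorem lineCount_eq_sum (Γ : Subgroup ((ZMod p)ˣ × (ZMod p)ˣ)) (s : ZMod p) :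
    (lineCount Γ s : ℂ) = ∑ g : Γ,
      (if (s + 1) * ((((g : (ZMod p)ˣ × (ZMod p)ˣ).2 : (ZMod p)ˣ) : ZMod p))
          = (((g : (ZMod p)ˣ × (ZMod p)ˣ).1 : (ZMod p)ˣ) : ZMod p) + s
        then (1 : ℂ) else 0) := by
  unfold lineCount
  rw [Fintype.card_subtype, Finset.card_filter, Nat.cast_sum]
  simp only [Nat.cast_ite, Nat.cast_one, Nat.cast_zero]

/-- The counting identity: `(p - 1) · lineCount Γ s = ∑_χ χ((s+1)⁻¹) · lineSum Γ s χ`. -/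
theorem count_identity_pair (Γ : Subgroup ((ZMod p)ˣ × (ZMod p)ˣ)) (s : ZMod p)
    (hs1 : s + 1 ≠ 0) :
    ((p : ℂ) - 1) * (lineCount Γ s : ℂ)
      = ∑ χ : DirichletCharacter ℂ p, χ (s + 1)⁻¹ * lineSum Γ s χ := by
  symm
  calc ∑ χ : DirichletCharacter ℂ p, χ (s + 1)⁻¹ * lineSum Γ s χ
      = ∑ χ : DirichletCharacter ℂ p, ∑ g : Γ,
          χ (s + 1)⁻¹ * χ ((((g : (ZMod p)ˣ × (ZMod p)ˣ).1 : (ZMod p)ˣ) : ZMod p) + s) *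
            χ ((((g : (ZMod p)ˣ × (ZMod p)ˣ).2)⁻¹ : (ZMod p)ˣ) : ZMod p) := by
        refine Finset.sum_congr rfl fun χ _ => ?_
        rw [lineSum, Finset.mul_sum]
        exact Finset.sum_congr rfl fun g _ => by ring
    _ = ∑ g : Γ, ∑ χ : DirichletCharacter ℂ p,
          χ (s + 1)⁻¹ * χ ((((g : (ZMod p)ˣ × (ZMod p)ˣ).1 : (ZMod p)ˣ) : ZMod p) + s) *
            χ ((((g : (ZMod p)ˣ × (ZMod p)ˣ).2)⁻¹ : (ZMod p)ˣ) : ZMod p) := Finset.sum_comm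
    _ = ∑ g : Γ,
          (if (s + 1) * ((((g : (ZMod p)ˣ × (ZMod p)ˣ).2 : (ZMod p)ˣ) : ZMod p))
              = (((g : (ZMod p)ˣ × (ZMod p)ˣ).1 : (ZMod p)ˣ) : ZMod p) + s
            then ((p : ℂ) - 1) else 0) := by
        simp_rw [sum_char_sol s hs1]
    _ = ((p : ℂ) - 1) * (lineCount Γ s : ℂ) := by
        rw [lineCount_eq_sum, Finset.mul_sum]
        refine Finset.sum_congr rfl fun g _ => ?_
        split_ifs <;> ring

/-- The trivial-character term: `Re (lineSum Γ s 1) ≥ |Γ| - (p - 1)` (at most `p - 1` elements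
of `Γ` have first coordinate `-s`, since they are determined by their second coordinate). -/
theorem re_lineSum_one_ge (Γ : Subgroup ((ZMod p)ˣ × (ZMod p)ˣ)) (s : ZMod p) :
    (Nat.card Γ : ℝ) - ((p : ℝ) - 1) ≤ (lineSum Γ s (1 : DirichletCharacter ℂ p)).re := by
  have hterm : ∀ g : Γ, (1 : DirichletCharacter ℂ p)
        ((((g : (ZMod p)ˣ × (ZMod p)ˣ).1 : (ZMod p)ˣ) : ZMod p) + s) *
        (1 : DirichletCharacter ℂ p) ((((g : (ZMod p)ˣ × (ZMod p)ˣ).2)⁻¹ : (ZMod p)ˣ) : ZMod p)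
      = 1 - (if (((g : (ZMod p)ˣ × (ZMod p)ˣ).1 : (ZMod p)ˣ) : ZMod p) + s = 0
          then (1 : ℂ) else 0) := by
    intro g
    rw [MulChar.one_apply (Units.isUnit _), mul_one]
    by_cases h0 : (((g : (ZMod p)ˣ × (ZMod p)ˣ).1 : (ZMod p)ˣ) : ZMod p) + s = 0
    · rw [MulChar.map_nonunit _ (by rw [isUnit_iff_ne_zero]; exact fun h => h h0), if_pos h0]
      simp
    · rw [MulChar.one_apply (isUnit_iff_ne_zero.mpr h0), if_neg h0]
      simp
  unfold lineSum
  simp_rw [hterm, Finset.sum_sub_distrib, Complex.sub_re, Complex.re_sum]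
  simp only [Finset.sum_const, Finset.card_univ, nsmul_eq_mul, mul_one,
    Complex.one_re, Nat.card_eq_fintype_card]
  have hle : ∑ g : Γ, (if (((g : (ZMod p)ˣ × (ZMod p)ˣ).1 : (ZMod p)ˣ) : ZMod p) + s = 0
      then (1 : ℂ) else 0).re ≤ (p : ℝ) - 1 := by
    rw [← Complex.re_sum]
    have : (∑ g : Γ, (if (((g : (ZMod p)ˣ × (ZMod p)ˣ).1 : (ZMod p)ˣ) : ZMod p) + s = 0
        then (1 : ℂ) else 0))
        = ((Finset.univ.filter fun g : Γ =>
            (((g : (ZMod p)ˣ × (ZMod p)ˣ).1 : (ZMod p)ˣ) : ZMod p) + s = 0).card : ℂ) := by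
      rw [Finset.card_filter]; push_cast; rfl
    rw [this, Complex.natCast_re]
    have hcard : (Finset.univ.filter fun g : Γ =>
        (((g : (ZMod p)ˣ × (ZMod p)ˣ).1 : (ZMod p)ˣ) : ZMod p) + s = 0).card
          ≤ (Finset.univ : Finset (ZMod p)ˣ).card := by
      refine Finset.card_le_card_of_injOn (fun g => (g : (ZMod p)ˣ × (ZMod p)ˣ).2)
        (fun _ _ => Finset.mem_univ _) fun a ha b hb hab => ?_
      rw [Finset.coe_filter, Set.mem_setOf_eq] at ha hb
      have h1 : (((a : (ZMod p)ˣ × (ZMod p)ˣ).1 : (ZMod p)ˣ) : ZMod p)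
          = (((b : (ZMod p)ˣ × (ZMod p)ˣ).1 : (ZMod p)ˣ) : ZMod p) := by
        rw [← add_left_inj s, ha.2, hb.2]
      exact Subtype.ext (Prod.ext (Units.ext h1) hab)
    rw [Finset.card_univ, ZMod.card_units p] at hcard
    have h' : ((Finset.univ.filter fun g : Γ =>
        (((g : (ZMod p)ˣ × (ZMod p)ˣ).1 : (ZMod p)ˣ) : ZMod p) + s = 0).card : ℝ)
          ≤ ((p - 1 : ℕ) : ℝ) := by exact_mod_cast hcard
    rw [Nat.cast_sub hp.out.one_le, Nat.cast_one] at h'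
    exact h'
  linarith

/-- **Main estimate.** For a subgroup `Γ ≤ 𝔽ₚˣ × 𝔽ₚˣ` and `s` with `s ≠ 0`, `s + 1 ≠ 0`:
`|Γ| ≤ (p - 1)·(lineCount Γ s + 1 + √p)`. -/
theorem subgroup_line_count (Γ : Subgroup ((ZMod p)ˣ × (ZMod p)ˣ)) (s : ZMod p) (hs : s ≠ 0)
    (hs1 : s + 1 ≠ 0) :
    (Nat.card Γ : ℝ) ≤ ((p : ℝ) - 1) * (lineCount Γ s + 1 + Real.sqrt p) := by
  have hp1 : (0 : ℝ) < (p : ℝ) - 1 := by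
    have : (1 : ℝ) < p := by exact_mod_cast hp.out.one_lt
    linarith
  -- abbreviations
  set f : DirichletCharacter ℂ p → ℂ := fun χ => χ (s + 1)⁻¹ * lineSum Γ s χ with hf
  have hid : ((p : ℂ) - 1) * (lineCount Γ s : ℂ) = ∑ χ : DirichletCharacter ℂ p, f χ :=
    count_identity_pair Γ s hs1
  have hsplit : ∑ χ : DirichletCharacter ℂ p, f χ
      = f 1 + ∑ χ ∈ (Finset.univ : Finset (DirichletCharacter ℂ p)).erase 1, f χ :=
    (Finset.add_sum_erase _ f (Finset.mem_univ _)).symm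
  -- the trivial term
  have hu : IsUnit (s + 1)⁻¹ := isUnit_iff_ne_zero.mpr (inv_ne_zero hs1)
  have h11 : (1 : DirichletCharacter ℂ p) (s + 1)⁻¹ = 1 := MulChar.one_apply hu
  have hf1 : f 1 = lineSum Γ s 1 := by simp only [hf, h11, one_mul]
  have hre1 : (Nat.card Γ : ℝ) - ((p : ℝ) - 1) ≤ (f 1).re := by
    rw [hf1]; exact re_lineSum_one_ge Γ s
  -- the error term
  have herr : ((p : ℝ) - 1) * ‖∑ χ ∈ (Finset.univ : Finset (DirichletCharacter ℂ p)).erase 1, f χ‖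
      ≤ Real.sqrt p * ((p : ℝ) - 1) ^ 2 := by
    calc ((p : ℝ) - 1) * ‖∑ χ ∈ (Finset.univ : Finset (DirichletCharacter ℂ p)).erase 1, f χ‖
        ≤ ((p : ℝ) - 1) *
            ∑ χ ∈ (Finset.univ : Finset (DirichletCharacter ℂ p)).erase 1, ‖f χ‖ :=
          mul_le_mul_of_nonneg_left (norm_sum_le _ _) hp1.le
      _ = ∑ χ ∈ (Finset.univ : Finset (DirichletCharacter ℂ p)).erase 1,
            ((p : ℝ) - 1) * ‖f χ‖ := by rw [Finset.mul_sum]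
      _ ≤ ∑ χ ∈ (Finset.univ : Finset (DirichletCharacter ℂ p)).erase 1,
            Real.sqrt p * ∑ θ : DirichletCharacter ℂ p, ‖pairSum Γ θ χ‖ := by
          refine Finset.sum_le_sum fun χ hχ => ?_
          have hχ1 : χ ≠ 1 := Finset.ne_of_mem_erase hχ
          simp only [hf, norm_mul]
          have h1 : ‖χ (s + 1)⁻¹‖ ≤ 1 := DirichletCharacter.norm_le_one χ _
          have h2 := norm_lineSum_le Γ s hs χ hχ1
          calc ((p : ℝ) - 1) * (‖χ (s + 1)⁻¹‖ * ‖lineSum Γ s χ‖)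
              ≤ ((p : ℝ) - 1) * (1 * ‖lineSum Γ s χ‖) := by gcongr
            _ = ((p : ℝ) - 1) * ‖lineSum Γ s χ‖ := by ring
            _ ≤ Real.sqrt p * ∑ θ : DirichletCharacter ℂ p, ‖pairSum Γ θ χ‖ := h2
      _ ≤ ∑ χ : DirichletCharacter ℂ p,
            Real.sqrt p * ∑ θ : DirichletCharacter ℂ p, ‖pairSum Γ θ χ‖ :=
          Finset.sum_le_sum_of_subset_of_nonneg (Finset.erase_subset _ _)
            fun χ _ _ => mul_nonneg (Real.sqrt_nonneg _)
              (Finset.sum_nonneg fun θ _ => norm_nonneg _)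
      _ = Real.sqrt p * ((p : ℝ) - 1) ^ 2 := by
          rw [← Finset.mul_sum, Finset.sum_comm, sum_norm_pairSum]
  have herr' : ‖∑ χ ∈ (Finset.univ : Finset (DirichletCharacter ℂ p)).erase 1, f χ‖
      ≤ Real.sqrt p * ((p : ℝ) - 1) := by
    have : ((p : ℝ) - 1) * ‖∑ χ ∈ (Finset.univ : Finset (DirichletCharacter ℂ p)).erase 1, f χ‖
        ≤ ((p : ℝ) - 1) * (Real.sqrt p * ((p : ℝ) - 1)) := by nlinarith [herr]
    exact le_of_mul_le_mul_left this hp1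
  -- combine real parts
  have hre : (((p : ℂ) - 1) * (lineCount Γ s : ℂ)).re = ((p : ℝ) - 1) * lineCount Γ s := by
    simp [Complex.mul_re]
  have hmain : ((p : ℝ) - 1) * lineCount Γ s
      = (f 1).re + (∑ χ ∈ (Finset.univ : Finset (DirichletCharacter ℂ p)).erase 1, f χ).re := by
    rw [← hre, hid, hsplit, Complex.add_re]
  have hlow := (abs_le.mp (Complex.abs_re_le_norm
    (∑ χ ∈ (Finset.univ : Finset (DirichletCharacter ℂ p)).erase 1, f χ))).1
  nlinarith [hre1, herr', hmain, hlow, Real.sqrt_nonneg (p : ℝ)]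

/-- **Corollary.** If `(1, 1)` is the only point of the line `α + s = (s+1)β` on `Γ`
(`s ≠ 0, -1`), then `|Γ| ≤ (p - 1)(2 + √p)`. -/
theorem card_le_of_line_trivial (Γ : Subgroup ((ZMod p)ˣ × (ZMod p)ˣ)) (s : ZMod p)
    (hs : s ≠ 0) (hs1 : s + 1 ≠ 0)
    (huniq : ∀ g : Γ, (s + 1) * ((((g : (ZMod p)ˣ × (ZMod p)ˣ).2 : (ZMod p)ˣ) : ZMod p))
      = (((g : (ZMod p)ˣ × (ZMod p)ˣ).1 : (ZMod p)ˣ) : ZMod p) + s → g = 1) :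
    (Nat.card Γ : ℝ) ≤ ((p : ℝ) - 1) * (2 + Real.sqrt p) := by
  have hN : lineCount Γ s ≤ 1 := by
    unfold lineCount
    refine Fintype.card_le_one_iff_subsingleton.mpr ⟨fun a b => Subtype.ext ?_⟩
    rw [huniq a.1 a.2, huniq b.1 b.2]
  have hN' : (lineCount Γ s : ℝ) ≤ 1 := by exact_mod_cast hN
  have hp1 : (0 : ℝ) ≤ (p : ℝ) - 1 := by
    have : (1 : ℝ) ≤ p := by exact_mod_cast hp.out.one_lt.le
    linarith
  calc (Nat.card Γ : ℝ) ≤ ((p : ℝ) - 1) * (lineCount Γ s + 1 + Real.sqrt p) :=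
        subgroup_line_count Γ s hs hs1
    _ ≤ ((p : ℝ) - 1) * (1 + 1 + Real.sqrt p) := by gcongr
    _ = ((p : ℝ) - 1) * (2 + Real.sqrt p) := by ring

end Summit.MatrixMultiplication.MatrixMultiplication.Theorems.SubgroupIdentityDesigns.Negative.ShiftedSubgroup
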